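/-
Origin: expansion seat `prover-pub-hodgecm-mc-binder-2-g19-0`, handover #99 2026-08-21T00:21Z md5 e84c4ba22f02 (NEW; 266 l.; ns HodgeCM.Model.SplitLine (§1) + HodgeCM.Model (§2); DISCHARGES #98's hypothesis hsmooth for every split line with CONTINUOUS pair splitting (hypothesis Continuous (pairSplitting L⁺ L c 3 1 p.e JV p.JW p.s), the currency of the vendored continuous_pairSmall₁ ∕ continuous_pairSplitting_splittingOf hGR): **SplitLine.finPairRepW_smooth** ∕ **SplitLine.finPairRepV_smooth** (BOTH members of ω_f ∘ s_pair SMOOTH on 𝒮((𝔸_{L⁺}^∞)^{3·1}): every finite test vector has an open principal-congruence stabiliser; vendored engine Weil1964.exists_finCongruenceLevel_forall_forall_finRepMp_cosetIndicatorSB_eq_self [GR91 §3.1 p. 454; MVW Ch. 2 I.3] via exists_level_of_mem_schwartzBruhat + exists_eq_sum_smul_finTranslateSB_indicatorSB and harch = proj_pairSmall₁_finAdelic_apply_archVec; the V statement = generic form of sinst-1's finRepZero_smooth), **SplitLine.Ω_smooth** (continuous ιV: Ω(p,χ) is a SMOOTH ℂ[U(V)(𝔸_f)]-module — every class in fixedBy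 K for an open K), SplitLine.subsingleton_Ω_of_not_isLevelTrivial_of_continuous ((R2) with hsmooth discharged), SplitLine.isLevelTrivial_of_nontrivial_Ω, **isLevelTrivial_of_irreducible_of_continuous** (K0 RIDER 1 AS A THEOREM at continuously split index lines: the cited [Liu21 Def. 4.11] FORCES GoodChar i χ → (line i).IsLevelTrivial χ), not_irreducible_of_not_isLevelTrivial, goodChar_le_isLevelTrivial_of_irreducible. CERT lane farm lean-direct over g19∕farm∕mirror = PKG RUN-66 oleans + the RUN-67 cone rebuilt over theta-3 #S14r3 829cc9ef6ec6 (r3 → LiuDictionaryInstance → JLiuHermLineType → #6r2 → #98, all rc 0): rc 0 ∕ 98 s ∕ 0 warn ∕ 0 proof holes; #print axioms 8 ∕ 8 ⊆ {propext, Classical.choice, Quot.sound}, proof-holeAx 0 (g19∕farm∕logs∕ax_k0s.log 1f4a9d061fe3); FQN 0 ∕ 8 vs headline-decls a933f2359af0 + PKG + other lanes' stage6x. NAME LIST (theorems): HodgeCM.Model.SplitLine.finPairRepW_smooth · HodgeCM.Model.SplitLine.Ω_smooth · HodgeCM.Model.isLevelTrivial_of_irreducible_of_continuous. (`HOME/mc/pub-hodgecm-mc-binder-2/g19/stage68/HodgeCM/Model/Binders/JLiuK0Smooth.lean`,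 md5 e84c4ba22f02, 266 lines);
landed by the second packager p2 gen 16 (p2-g16) in gate run 68 as `HodgeCM/Model/Binders/JLiuK0Smooth.lean` (verbatim).
-/
/-
Origin: BINDER seat `prover-pub-hodgecm-mc-binder-2-g19-0` (unit pub-hodgecm-mc-binder-2-g19, gen 19 of mc-binder-2), 2026-08-21.
Target in PKG: `HodgeCM/Model/Binders/JLiuK0Smooth.lean` (NEW additive KERNEL leaf beside E; imports binder-2 #98
`Model/Binders/JLiuK0Necessary` only; nothing imports it; outside E's import closure; E `Model/E2InstanceOGR21AEPI.lean`
4c667377ea4b untouched; MODEL-N ±0).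
KERNEL ONLY: theorems; 0 defs, 0 records, nothing cited, 0 `def … : Prop`. Nothing here is a claim of the manuscripts under adjudication.
-/
import Summits.HodgeConjecture.HodgeCM.Model.Binders.JLiuK0Necessary

set_option autoImplicit false

/-!
# (J3) K0 — SMOOTHNESS of the finite Weil representation of a split line with CONTINUOUS splitting,
# and K0 RIDER 1 unconditionally at such lines

binder-2 #98 (`JLiuK0Necessary`) proved theta-3-g26's (R2) under the hypothesis `hsmooth` («every Schwartz–Bruhat vector
has an open stabiliser under the `U(W)(𝔸_f)`-member `finPairRepW` of the finite Weil representation of the line»).  This leaf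
DISCHARGES `hsmooth` for every split line `p` whose pair splitting `p.s : U(J_V)(𝔸) ×' U(J_W)(𝔸) →* Mp_ψ(𝕎_𝔸)ᶜᵒⁿᵗ` is
CONTINUOUS (hypothesis `Continuous (pairSplitting … p.s)`, the currency of `continuous_pairSmall₁`) — the case of every splitting of record ([GelbartRogawski1991, Prop. 3.1.1]: `continuous_splittingOf`, the CM
pair splittings of the honest side) — from the vendored level-fixing engine
`Weil1964.exists_finCongruenceLevel_forall_forall_finRepMp_cosetIndicatorSB_eq_self` ([GelbartRogawski1991, §3.1 p. 454];
[MoeglinVignerasWaldspurger1987, Chap. 2 I.3]: every vector of the Weil representation is fixed by a compact open subgroup)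
through the coset decomposition of a finite test vector (`exists_level_of_mem_schwartzBruhat`,
`exists_eq_sum_smul_finTranslateSB_indicatorSB`) and the `harch` clause `proj_pairSmall₁_finAdelic_apply_archVec`:

* `SplitLine.finPairRepW_smooth` / `SplitLine.finPairRepV_smooth` — BOTH members of `ω_f ∘ s_pair` are SMOOTH on
  `𝒮((𝔸_{L⁺}^∞)^{3·1})` (open stabilisers; the `V`-statement is the generic form of sinst-1's `finRepZero_smooth`);
* `SplitLine.Ω_smooth` — for a continuous pullback hom `ιV`, `Ω(p, χ)` is a SMOOTH `ℂ[U(V)(𝔸_f)]`-module (every class is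
  fixed by an open subgroup);
* `SplitLine.subsingleton_Ω_of_not_isLevelTrivial_of_continuous` — (R2) with `hsmooth` discharged:
  `Continuous p.s → ¬ p.IsLevelTrivial χ → Ω(p, χ) = 0`;
* **`isLevelTrivial_of_irreducible_of_continuous`** — K0 RIDER 1 AS A THEOREM at every index line with continuous splitting:
  the cited [Liu21, Def. 4.11] (`Irreducible` of the pinned dictionary) FORCES `GoodChar i χ → (line i).IsLevelTrivial χ`;
  contrapositive `not_irreducible_of_not_isLevelTrivial` (a pin admitting ONE discontinuous good character on a continuously
  split line refutes `hcite`).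
Necessary conditions only; nothing is asserted about any instance.
-/

noncomputable section

open Function Set
open NumberField NumberField.mixedEmbedding IsDedekindDomain
open scoped Matrix Kronecker TensorProduct
open Literature.AlgebraicGeometry.Motives
open Literature.AlgebraicGeometry.ShimuraVarieties
open Literature.AlgebraicGeometry.HodgeTheory
open Literature.NumberTheory.Automorphic
open Literature.NumberTheory.Automorphic.PicardCM
open Literature.NumberTheory.Weil1964
open Literature.NumberTheory.GelbartRogawski1991 Literature.NumberTheory.GelbartRogawski1991.UnitaryDualPair
open Literature.NumberTheory.Transcendental (Arapura2012_Cor_15_4_6)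

namespace HodgeCM.Model

open HodgeCM.Model.TowerLevel HodgeCM.Model.TowerCarrier HodgeCM.Literature.Theta HodgeCM.Literature.Theta.LiuAlbaneseModuleDatum
open HodgeCM.CMTypeOps (inflate)
open HodgeCM.Universe (ThetaModel)

/-! ## §1. Smoothness of `ω_f ∘ s_pair` for a continuous pair splitting -/

namespace SplitLine

variable {L : CMField} {ι₁ : (L : Type) →+* ℂ} {V : HermSpace3 L ι₁}
  {JV : Matrix (Fin 3) (Fin 3) (L : Type)} {TV : Matrix (Fin 3) (Fin 3) ↥(maximalRealSubfield (L : Type))}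
  {δ : (L : Type)} {hcδ : IsCMField.complexConj (L : Type) δ = -δ} {hδ : δ ≠ 0} {d : ↥(maximalRealSubfield (L : Type))}
  {hd : δ * δ = algebraMap _ (L : Type) d} {hV : TV.IsSymm} {hVd : IsUnit TV.det}
  {hJV : JV = TV.map (algebraMap _ (L : Type))}
  (p : SplitLine JV TV hcδ hδ hd hV hVd hJV)
  (ιV : ↥V.adelicFin →*
    ↥(UnitaryGroup.finAdelic (↥(maximalRealSubfield (L : Type))) (L : Type) (IsCMField.complexConj (L : Type)) 3 JV))

/-- **the `U(J_W)(𝔸_f)`-member of `ω_f ∘ s_pair` is SMOOTH** for a continuous pair splitting: every finite test vector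
`v ∈ 𝒮((𝔸^∞)^{3·1})` is fixed by an OPEN subgroup (a principal congruence level) of `U(J_W)(𝔸_f)`.
[folklore] -/
theorem finPairRepW_smooth (hsc : Continuous (pairSplitting (↥(maximalRealSubfield (L : Type))) (L : Type) (IsCMField.complexConj (L : Type)) 3 1 p.e JV p.JW p.s))
    (v : FinSB (↥(maximalRealSubfield (L : Type))) (Fin 3 × Fin 1)) :
    ∃ K : Subgroup ↥(UnitaryGroup.finAdelic (↥(maximalRealSubfield (L : Type))) (L : Type)
        (IsCMField.complexConj (L : Type)) 1 p.JW),
      IsOpen (K : Set ↥(UnitaryGroup.finAdelic (↥(maximalRealSubfield (L : Type))) (L : Type)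
        (IsCMField.complexConj (L : Type)) 1 p.JW)) ∧
      ∀ u ∈ K, HodgeCM.WeilCoinv.finPairRepW (↥(maximalRealSubfield (L : Type))) (L : Type)
        (IsCMField.complexConj (L : Type)) 3 1 p.e JV p.JW hcδ hδ hd hV p.hW hVd p.hWd hJV p.hJW p.hs u v = v := by
  -- `ω_f ∘ s_pair` on the finite-adelic pair, its `W`-member `σ`, continuity and the `harch` clause
  let σ₀ := (pairSmall₁ (↥(maximalRealSubfield (L : Type))) (L : Type) (IsCMField.complexConj (L : Type)) 3 1 p.e JV p.JW p.s).comp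
      (HodgeCM.WeilCoinv.finPairToAdelic (↥(maximalRealSubfield (L : Type))) (L : Type) (IsCMField.complexConj (L : Type)) 3 1 JV p.JW)
  let σ := σ₀.comp (MonoidHom.inr _ _)
  have hσ₀ : Continuous σ₀ :=
    (continuous_pairSmall₁ (↥(maximalRealSubfield (L : Type))) (L : Type) (IsCMField.complexConj (L : Type)) 3 1 p.e JV p.JW hsc).comp
      ((UnitaryGroup.continuous_finAdelicToAdelic _ _ _ _ _).prodMap (UnitaryGroup.continuous_finAdelicToAdelic _ _ _ _ _))
  have hσ : Continuous σ := hσ₀.comp (continuous_const.prodMk continuous_id)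
  have harch₀ : ∀ (q : ↥(UnitaryGroup.finAdelic (↥(maximalRealSubfield (L : Type))) (L : Type) (IsCMField.complexConj (L : Type)) 3 JV) ×
      ↥(UnitaryGroup.finAdelic (↥(maximalRealSubfield (L : Type))) (L : Type) (IsCMField.complexConj (L : Type)) 1 p.JW))
      (a w : Fin 3 × Fin 1 → mixedSpace ↥(maximalRealSubfield (L : Type))),
      (adelicMpCont.proj (↥(maximalRealSubfield (L : Type))) (Fin 3 × Fin 1) _ (σ₀ q)).1
        (archVec (↥(maximalRealSubfield (L : Type))) (Fin 3 × Fin 1) a, archVec (↥(maximalRealSubfield (L : Type))) (Fin 3 × Fin 1) w) =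
        (archVec (↥(maximalRealSubfield (L : Type))) (Fin 3 × Fin 1) a, archVec (↥(maximalRealSubfield (L : Type))) (Fin 3 × Fin 1) w) :=
    fun q a w => proj_pairSmall₁_finAdelic_apply_archVec (↥(maximalRealSubfield (L : Type))) (L : Type) (IsCMField.complexConj (L : Type))
      3 1 p.e JV p.JW hcδ hδ hd hV p.hW hVd p.hWd hJV p.hJW p.hs q.1 q.2 a w
  have harch : ∀ (u : ↥(UnitaryGroup.finAdelic (↥(maximalRealSubfield (L : Type))) (L : Type) (IsCMField.complexConj (L : Type)) 1 p.JW))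
      (a w : Fin 3 × Fin 1 → mixedSpace ↥(maximalRealSubfield (L : Type))),
      (adelicMpCont.proj (↥(maximalRealSubfield (L : Type))) (Fin 3 × Fin 1) _ (σ u)).1
        (archVec (↥(maximalRealSubfield (L : Type))) (Fin 3 × Fin 1) a, archVec (↥(maximalRealSubfield (L : Type))) (Fin 3 × Fin 1) w) =
        (archVec (↥(maximalRealSubfield (L : Type))) (Fin 3 × Fin 1) a, archVec (↥(maximalRealSubfield (L : Type))) (Fin 3 × Fin 1) w) :=
    fun u a w => harch₀ (1, u) a w
  -- `finPairRepW u` IS `finRepMp σ u` (definitionally)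
  have hrep : ∀ u, HodgeCM.WeilCoinv.finPairRepW (↥(maximalRealSubfield (L : Type))) (L : Type)
      (IsCMField.complexConj (L : Type)) 3 1 p.e JV p.JW hcδ hδ hd hV p.hW hVd p.hWd hJV p.hJW p.hs u =
      finRepMp (isUnit_kronecker_map (↥(maximalRealSubfield (L : Type))) 3 hVd p.hWd) σ harch u := fun u => rfl
  -- a level of `v` and its coset decomposition
  obtain ⟨𝔫, -, hlev⟩ := exists_level_of_mem_schwartzBruhat (↥(maximalRealSubfield (L : Type))) v.2
  obtain ⟨s, hs⟩ := exists_eq_sum_smul_finTranslateSB_indicatorSB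
    (piLevelIdeal (↥(maximalRealSubfield (L : Type))) (Fin 3 × Fin 1) 𝔫)
    (isOpen_piLevelIdeal (↥(maximalRealSubfield (L : Type))) 𝔫)
    (isCompact_piLevelIdeal (↥(maximalRealSubfield (L : Type))) (Fin 3 × Fin 1) 𝔫) v hlev
  -- ONE principal congruence level fixing the finitely many coset indicators
  obtain ⟨𝔪, h𝔪, hfix⟩ := exists_finCongruenceLevel_forall_forall_finRepMp_cosetIndicatorSB_eq_self (A := ↥s)
    (isUnit_kronecker_map (↥(maximalRealSubfield (L : Type))) 3 hVd p.hWd) σ hσ harch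
    (fun q => (q.1.out : Fin 3 × Fin 1 → FiniteAdeleRing (𝓞 ↥(maximalRealSubfield (L : Type))) ↥(maximalRealSubfield (L : Type))))
    (fun _ => 𝔫)
  refine ⟨UnitaryGroup.finCongruenceLevel _ _ _ _ _ 𝔪, UnitaryGroup.isOpen_finCongruenceLevel _ _ _ _ _ h𝔪, fun u hu => ?_⟩
  have hq : ∀ q ∈ s, HodgeCM.WeilCoinv.finPairRepW (↥(maximalRealSubfield (L : Type))) (L : Type)
      (IsCMField.complexConj (L : Type)) 3 1 p.e JV p.JW hcδ hδ hd hV p.hW hVd p.hWd hJV p.hJW p.hs u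
        (cosetIndicatorSB _ _ (q.out : Fin 3 × Fin 1 → FiniteAdeleRing (𝓞 ↥(maximalRealSubfield (L : Type))) _) 𝔫) =
      cosetIndicatorSB _ _ (q.out : Fin 3 × Fin 1 → FiniteAdeleRing (𝓞 ↥(maximalRealSubfield (L : Type))) _) 𝔫 :=
    fun q hqs => by rw [hrep]; exact hfix ⟨q, hqs⟩ u hu
  have hs' : v = ∑ q ∈ s, ((v : (Fin 3 × Fin 1 → FiniteAdeleRing (𝓞 ↥(maximalRealSubfield (L : Type)))
      ↥(maximalRealSubfield (L : Type))) → ℂ) q.out) •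
        cosetIndicatorSB _ _ (q.out : Fin 3 × Fin 1 → FiniteAdeleRing (𝓞 ↥(maximalRealSubfield (L : Type))) _) 𝔫 := hs
  conv_lhs => rw [hs']
  rw [map_sum]
  conv_rhs => rw [hs']
  exact Finset.sum_congr rfl fun q hq' => by rw [map_smul, hq q hq']

/-- **the `U(J_V)(𝔸_f)`-member of `ω_f ∘ s_pair` is SMOOTH** for a continuous pair splitting (generic form of sinst-1's
`finRepZero_smooth`). [folklore] -/
theorem finPairRepV_smooth (hsc : Continuous (pairSplitting (↥(maximalRealSubfield (L : Type))) (L : Type) (IsCMField.complexConj (L : Type)) 3 1 p.e JV p.JW p.s))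
    (v : FinSB (↥(maximalRealSubfield (L : Type))) (Fin 3 × Fin 1)) :
    ∃ K : Subgroup ↥(UnitaryGroup.finAdelic (↥(maximalRealSubfield (L : Type))) (L : Type)
        (IsCMField.complexConj (L : Type)) 3 JV),
      IsOpen (K : Set ↥(UnitaryGroup.finAdelic (↥(maximalRealSubfield (L : Type))) (L : Type)
        (IsCMField.complexConj (L : Type)) 3 JV)) ∧
      ∀ k ∈ K, HodgeCM.WeilCoinv.finPairRepV (↥(maximalRealSubfield (L : Type))) (L : Type)
        (IsCMField.complexConj (L : Type)) 3 1 p.e JV p.JW hcδ hδ hd hV p.hW hVd p.hWd hJV p.hJW p.hs k v = v := by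
  -- `ω_f ∘ s_pair` on the finite-adelic pair, its `V`-member `σ`, continuity and the `harch` clause
  let σ₀ := (pairSmall₁ (↥(maximalRealSubfield (L : Type))) (L : Type) (IsCMField.complexConj (L : Type)) 3 1 p.e JV p.JW p.s).comp
      (HodgeCM.WeilCoinv.finPairToAdelic (↥(maximalRealSubfield (L : Type))) (L : Type) (IsCMField.complexConj (L : Type)) 3 1 JV p.JW)
  let σ := σ₀.comp (MonoidHom.inl _ _)
  have hσ₀ : Continuous σ₀ :=
    (continuous_pairSmall₁ (↥(maximalRealSubfield (L : Type))) (L : Type) (IsCMField.complexConj (L : Type)) 3 1 p.e JV p.JW hsc).comp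
      ((UnitaryGroup.continuous_finAdelicToAdelic _ _ _ _ _).prodMap (UnitaryGroup.continuous_finAdelicToAdelic _ _ _ _ _))
  have hσ : Continuous σ := hσ₀.comp (continuous_id.prodMk continuous_const)
  have harch₀ : ∀ (q : ↥(UnitaryGroup.finAdelic (↥(maximalRealSubfield (L : Type))) (L : Type) (IsCMField.complexConj (L : Type)) 3 JV) ×
      ↥(UnitaryGroup.finAdelic (↥(maximalRealSubfield (L : Type))) (L : Type) (IsCMField.complexConj (L : Type)) 1 p.JW))
      (a w : Fin 3 × Fin 1 → mixedSpace ↥(maximalRealSubfield (L : Type))),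
      (adelicMpCont.proj (↥(maximalRealSubfield (L : Type))) (Fin 3 × Fin 1) _ (σ₀ q)).1
        (archVec (↥(maximalRealSubfield (L : Type))) (Fin 3 × Fin 1) a, archVec (↥(maximalRealSubfield (L : Type))) (Fin 3 × Fin 1) w) =
        (archVec (↥(maximalRealSubfield (L : Type))) (Fin 3 × Fin 1) a, archVec (↥(maximalRealSubfield (L : Type))) (Fin 3 × Fin 1) w) :=
    fun q a w => proj_pairSmall₁_finAdelic_apply_archVec (↥(maximalRealSubfield (L : Type))) (L : Type) (IsCMField.complexConj (L : Type))
      3 1 p.e JV p.JW hcδ hδ hd hV p.hW hVd p.hWd hJV p.hJW p.hs q.1 q.2 a w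
  have harch : ∀ (k : ↥(UnitaryGroup.finAdelic (↥(maximalRealSubfield (L : Type))) (L : Type) (IsCMField.complexConj (L : Type)) 3 JV))
      (a w : Fin 3 × Fin 1 → mixedSpace ↥(maximalRealSubfield (L : Type))),
      (adelicMpCont.proj (↥(maximalRealSubfield (L : Type))) (Fin 3 × Fin 1) _ (σ k)).1
        (archVec (↥(maximalRealSubfield (L : Type))) (Fin 3 × Fin 1) a, archVec (↥(maximalRealSubfield (L : Type))) (Fin 3 × Fin 1) w) =
        (archVec (↥(maximalRealSubfield (L : Type))) (Fin 3 × Fin 1) a, archVec (↥(maximalRealSubfield (L : Type))) (Fin 3 × Fin 1) w) :=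
    fun k a w => harch₀ (k, 1) a w
  -- `finPairRepV k` IS `finRepMp σ k` (definitionally)
  have hrep : ∀ k, HodgeCM.WeilCoinv.finPairRepV (↥(maximalRealSubfield (L : Type))) (L : Type)
      (IsCMField.complexConj (L : Type)) 3 1 p.e JV p.JW hcδ hδ hd hV p.hW hVd p.hWd hJV p.hJW p.hs k =
      finRepMp (isUnit_kronecker_map (↥(maximalRealSubfield (L : Type))) 3 hVd p.hWd) σ harch k := fun k => rfl
  obtain ⟨𝔫, -, hlev⟩ := exists_level_of_mem_schwartzBruhat (↥(maximalRealSubfield (L : Type))) v.2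
  obtain ⟨s, hs⟩ := exists_eq_sum_smul_finTranslateSB_indicatorSB
    (piLevelIdeal (↥(maximalRealSubfield (L : Type))) (Fin 3 × Fin 1) 𝔫)
    (isOpen_piLevelIdeal (↥(maximalRealSubfield (L : Type))) 𝔫)
    (isCompact_piLevelIdeal (↥(maximalRealSubfield (L : Type))) (Fin 3 × Fin 1) 𝔫) v hlev
  obtain ⟨𝔪, h𝔪, hfix⟩ := exists_finCongruenceLevel_forall_forall_finRepMp_cosetIndicatorSB_eq_self (A := ↥s)
    (isUnit_kronecker_map (↥(maximalRealSubfield (L : Type))) 3 hVd p.hWd) σ hσ harch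
    (fun q => (q.1.out : Fin 3 × Fin 1 → FiniteAdeleRing (𝓞 ↥(maximalRealSubfield (L : Type))) ↥(maximalRealSubfield (L : Type))))
    (fun _ => 𝔫)
  refine ⟨UnitaryGroup.finCongruenceLevel _ _ _ _ _ 𝔪, UnitaryGroup.isOpen_finCongruenceLevel _ _ _ _ _ h𝔪, fun k hk => ?_⟩
  have hq : ∀ q ∈ s, HodgeCM.WeilCoinv.finPairRepV (↥(maximalRealSubfield (L : Type))) (L : Type)
      (IsCMField.complexConj (L : Type)) 3 1 p.e JV p.JW hcδ hδ hd hV p.hW hVd p.hWd hJV p.hJW p.hs k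
        (cosetIndicatorSB _ _ (q.out : Fin 3 × Fin 1 → FiniteAdeleRing (𝓞 ↥(maximalRealSubfield (L : Type))) _) 𝔫) =
      cosetIndicatorSB _ _ (q.out : Fin 3 × Fin 1 → FiniteAdeleRing (𝓞 ↥(maximalRealSubfield (L : Type))) _) 𝔫 :=
    fun q hqs => by rw [hrep]; exact hfix ⟨q, hqs⟩ k hk
  have hs' : v = ∑ q ∈ s, ((v : (Fin 3 × Fin 1 → FiniteAdeleRing (𝓞 ↥(maximalRealSubfield (L : Type)))
      ↥(maximalRealSubfield (L : Type))) → ℂ) q.out) •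
        cosetIndicatorSB _ _ (q.out : Fin 3 × Fin 1 → FiniteAdeleRing (𝓞 ↥(maximalRealSubfield (L : Type))) _) 𝔫 := hs
  conv_lhs => rw [hs']
  rw [map_sum]
  conv_rhs => rw [hs']
  exact Finset.sum_congr rfl fun q hq' => by rw [map_smul, hq q hq']

/-- **`Ω(p, χ)` is a SMOOTH `U(V)(𝔸_f)`-module** (continuous splitting, continuous pullback hom `ιV`): every class is fixed by an
OPEN subgroup of `↥V.adelicFin` — i.e. lies in the dictionary's `fixedBy K` for some open `K` (the «admissible ⊇ smooth» half of
[Liu21, Def. 4.11]'s «irreducible admissible», which the cited `Irreducible` ∕ `Prop413` presuppose of the pinned `Ω`). [folklore] -/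
theorem Ω_smooth (hsc : Continuous (pairSplitting (↥(maximalRealSubfield (L : Type))) (L : Type) (IsCMField.complexConj (L : Type)) 3 1 p.e JV p.JW p.s))
    (hιV : Continuous ιV) (χ : p.CharW) (x : p.Ω ιV χ) :
    ∃ K : Subgroup ↥V.adelicFin, IsOpen (K : Set ↥V.adelicFin) ∧ ∀ g ∈ K, (MonoidAlgebra.of ℂ ↥V.adelicFin g) • x = x := by
  obtain ⟨v, hv⟩ := HodgeCM.TwistedCoinv.mk_surjective (HodgeCM.WeilCoinv.finPairRepW (↥(maximalRealSubfield (L : Type)))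
    (L : Type) (IsCMField.complexConj (L : Type)) 3 1 p.e JV p.JW hcδ hδ hd hV p.hW hVd p.hWd hJV p.hJW p.hs) χ x
  obtain ⟨K, hK, hfix⟩ := p.finPairRepV_smooth hsc v
  refine ⟨K.comap ιV, ?_, fun g hg => ?_⟩
  · rw [Subgroup.coe_comap]
    exact hK.preimage hιV
  · change Representation.asAlgebraHom ((HodgeCM.WeilCoinv.weilCoinv (↥(maximalRealSubfield (L : Type))) (L : Type)
        (IsCMField.complexConj (L : Type)) 3 1 p.e JV p.JW hcδ hδ hd hV p.hW hVd p.hWd hJV p.hJW χ p.hs).comp ιV)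
        (MonoidAlgebra.of ℂ ↥V.adelicFin g) x = x
    rw [Representation.asAlgebraHom_of, MonoidHom.comp_apply, ← hv, HodgeCM.WeilCoinv.weilCoinv_mk,
      ← HodgeCM.WeilCoinv.finPairRepV_apply, hfix (ιV g) (Subgroup.mem_comap.1 hg)]

/-- **(R2) with `hsmooth` DISCHARGED**: for a split line with CONTINUOUS splitting, every character `χ` of `U(W)(𝔸_f)` that is
NOT level-trivial has ZERO coinvariants `Ω(p, χ)`. [folklore] -/
theorem subsingleton_Ω_of_not_isLevelTrivial_of_continuous (hsc : Continuous (pairSplitting (↥(maximalRealSubfield (L : Type))) (L : Type) (IsCMField.complexConj (L : Type)) 3 1 p.e JV p.JW p.s)) {χ : p.CharW}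
    (hχ : ¬ p.IsLevelTrivial χ) : Subsingleton (p.Ω ιV χ) :=
  p.subsingleton_Ω_of_not_isLevelTrivial ιV (p.finPairRepW_smooth hsc) hχ

/-- equivalently: NON-ZERO coinvariants on a continuously split line force the character to be level-trivial. [folklore] -/
theorem isLevelTrivial_of_nontrivial_Ω (hsc : Continuous (pairSplitting (↥(maximalRealSubfield (L : Type))) (L : Type) (IsCMField.complexConj (L : Type)) 3 1 p.e JV p.JW p.s)) {χ : p.CharW} [hΩ : Nontrivial (p.Ω ιV χ)] :
    p.IsLevelTrivial χ := by
  by_contra hχ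
  exact not_nontrivial_iff_subsingleton.2 (p.subsingleton_Ω_of_not_isLevelTrivial_of_continuous ιV hsc hχ) hΩ

end SplitLine

/-! ## §2. K0 RIDER 1 at index lines with continuous splitting -/

variable (hHD : exists_isReal_hodgeModel) (hI : hodgePQ_independent_of_hodgeModel)
  (h₁ : BallQuotientUniformised) (h₃ : CMAbelianVarietyRealised) (hA : Arapura2012_Cor_15_4_6)
variable {L : CMField} {ι₁ : (L : Type) →+* ℂ} (V : HermSpace3 L ι₁)
variable {JV : Matrix (Fin 3) (Fin 3) (L : Type)} {TV : Matrix (Fin 3) (Fin 3) ↥(maximalRealSubfield (L : Type))}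
  {δ : (L : Type)} {hcδ : IsCMField.complexConj (L : Type) δ = -δ} {hδ : δ ≠ 0} {d : ↥(maximalRealSubfield (L : Type))}
  {hd : δ * δ = algebraMap _ (L : Type) d} {hV : TV.IsSymm} {hVd : IsUnit TV.det}
  {hJV : JV = TV.map (algebraMap _ (L : Type))}
  (ιV : ↥V.adelicFin →*
    ↥(UnitaryGroup.finAdelic (↥(maximalRealSubfield (L : Type))) (L : Type) (IsCMField.complexConj (L : Type)) 3 JV))
  (I : Type) (line : I → SplitLine JV TV hcδ hδ hd hV hVd hJV) (GoodCharI : (i : I) → (line i).CharW → Prop)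

/-- **K0 RIDER 1 AS A THEOREM (continuous splittings)**: if the index line `line i` carries a CONTINUOUS pair splitting, the
cited [Liu21, Def. 4.11] for the pinned dictionary FORCES every good character of that index to be LEVEL-TRIVIAL.
[folklore] -/
theorem isLevelTrivial_of_irreducible_of_continuous
    (h : (liuDictionaryOfWeilFamily hHD hI h₁ h₃ hA V ιV I line GoodCharI).Irreducible) (i : I)
    (hsc : Continuous (pairSplitting (↥(maximalRealSubfield (L : Type))) (L : Type) (IsCMField.complexConj (L : Type)) 3 1
        (line i).e JV (line i).JW (line i).s)) {χ : (line i).CharW} (hχ : GoodCharI i χ) : (line i).IsLevelTrivial χ :=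
  isLevelTrivial_of_irreducible hHD hI h₁ h₃ hA V ιV I line GoodCharI h i ((line i).finPairRepW_smooth hsc) hχ

/-- contrapositive: a pin whose `GoodChar` admits ONE non-level-trivial character on a continuously split index line REFUTES
the cited `Irreducible` (so `hcite` is false there and the junction-form child is vacuous). [folklore] -/
theorem not_irreducible_of_not_isLevelTrivial (i : I) (hsc : Continuous (pairSplitting (↥(maximalRealSubfield (L : Type))) (L : Type) (IsCMField.complexConj (L : Type)) 3 1
        (line i).e JV (line i).JW (line i).s)) {χ : (line i).CharW}
    (hχ : GoodCharI i χ) (hlt : ¬ (line i).IsLevelTrivial χ) :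
    ¬ (liuDictionaryOfWeilFamily hHD hI h₁ h₃ hA V ιV I line GoodCharI).Irreducible := fun h =>
  hlt (isLevelTrivial_of_irreducible_of_continuous hHD hI h₁ h₃ hA V ιV I line GoodCharI h i hsc hχ)

/-- **all-continuous pins**: if EVERY index line has a continuous splitting, `Irreducible` forces `GoodChar ≤ IsLevelTrivial`
pointwise — the continuity cut of the `GoodChar` of record (`IsAutChar`, axioms-1 #6r2) is NECESSARY, not a design choice.
[folklore] -/
theorem goodChar_le_isLevelTrivial_of_irreducible (hsc : ∀ i, Continuous (pairSplitting (↥(maximalRealSubfield (L : Type))) (L : Type) (IsCMField.complexConj (L : Type)) 3 1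
        (line i).e JV (line i).JW (line i).s))
    (h : (liuDictionaryOfWeilFamily hHD hI h₁ h₃ hA V ιV I line GoodCharI).Irreducible) (i : I) (χ : (line i).CharW) :
    GoodCharI i χ → (line i).IsLevelTrivial χ :=
  isLevelTrivial_of_irreducible_of_continuous hHD hI h₁ h₃ hA V ιV I line GoodCharI h i (hsc i)

end HodgeCM.Model

end
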